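import Summits.BirchSwinnertonDyer.BirchSwinnertonDyer.Theorems.ThetaPartnerAtTwoSignedKatoUpToAtTwoLocalTwoPlusPointsLayer
import Summits.BirchSwinnertonDyer.BirchSwinnertonDyer.Theorems.ThetaPartnerAtTwoSignedControlAtTwoPlusLayerTwoField
import Summits.BirchSwinnertonDyer.Rank1Residual.Additive.KobayashiLayerLogDescent
import HarnessLib

/-!
# HONDA⁺@2, assembly brick (iv): the LOGARITHM OF THE PLUS HONDA POINT for an ARBITRARY inverter `σ` of `ζ_{2^{n+2}}`,
# `Λ(e_n) = ℓ_{n+2} + σℓ_{n+2} = Σ_k (−1)^k v_{n+2−2k}/2^k ≡ v_{n+2} (mod ℚ₂(u_n))`, and the MODEL-LEVEL GENERATOR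
# `g_n = c̃_{n+2} + σ·c̃_{n+2}` (the K3 lead's `e_n`, read on the `ℤ₂`-model)
# (K4 `SignedControlAtTwo`, stmt-BirchSwinnertonDyer-20309, line `eulerchar` v6, stub `stub_plusHondaSystemTwo`)

Route `ThetaPartnerAtTwo` (TP2; crux shared with `ResidualThetaTransportAtTwo`), crux K4, line `eulerchar` v6 (8d2b4be25f391f24,
lead `prover-bsd-wall-tp2-p3` g2); seat `prover-bsd-wall-tp2-p3-w3` (width seat 3/3, g2 — the K4 assembler).

WHY. The K3 lead's tower points (`SignedKatoOffTwo.LocalTwo.plusPointsLayer_two`, p589796) are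
`d_n = 3 • (c_{n+2} + σ_{n+2} • c_{n+2}) − 2 • c_1` with `Λ(c̃_m) = ℓ_m = KobayashiTowerPoints.ell 2 m` on the model
`M_W` and `σ_m` an inverter of `ζ_{2^m}`; they come with (L), (TR), (NONDIV). The generation step along the plus tower — the
lead's `SignedEC.PlusTower.exists_sub_closure_sub_two_smul_plus` (input `heℓ : Λ(e) − v_{N+1} ∈ ℚ₂(v_N)`) and width seat 2's
`SignedEC.PlusLayer.exists_sub_closure_sub_two_smul_mem_plus` (D4) (input `hgv : Λ g − (u_{n+2} − 2) ∈ ℚ₂(u_{n+1})`) — needs a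
MODEL-LEVEL generator `g ∈ L(n+2) ∩ E₁` whose logarithm is `v_{n+2} = u_{n+2} − 2` modulo the previous plus field. THIS FILE
supplies it for K3's actual points: `g_n := c̃_{n+2} + act σ c̃_{n+2}` (`toLoc g_n = c_{n+2} + σ • c_{n+2} = e_n`), with
`Λ(g_n) = ℓ_{n+2} + σ•ℓ_{n+2} = Σ_k (−1)^k v_{n+2−2k}/2^k ≡ v_{n+2} (mod ℚ₂(u_n))` — the lead's memo LAGPLUS-AT-2-CONSTRUCTION
§2 formula `log e_n = Σ_k (−1)^k v_{n−2k}/2^k`, here a theorem. RELATION TO THE LEAD'S FILE VII (`…PlusHondaPointsTwo`,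
`PlusTower.plusPoint_mem`): that theorem takes the SPECIFIC inverter class `ι ζ_{2^{N+2}} = −ζ_{2^{N+2}}⁻¹` and concludes in the
`v`-currency by `ι`-descent; here `σ` is ANY inverter of `ζ_{2^{n+2}}` — the binder of K3's `plusPointsLayer_two`
(`∀ m ≥ 1, σ m • zeta 2 m = (zeta 2 m)⁻¹`), whose `d n = 3 • (c (n+2) + σ (n+2) • c (n+2)) − 2 • c 1` is the family the assembly
must use (it carries (L), (TR), (NONDIV)) — and the proof is the explicit sum. The generator conversion `e_n ↦ d_n` is width seat 2's
`SignedEC.PlusLayer.plusGen_of_plusGen_generator_change` (`…PlusGenBridgeTwo`), not repeated here.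

WHAT (THEOREMS ONLY).
* §1 (cyclotomic algebra in `ℚ̄₂`, `u_m = zeta 2 m + (zeta 2 m)⁻¹`, `v_m = u_m − 2`, `σ` ANY inverter of `ζ_{2^m}`)
  `smul_ell_two_of_inverter` (`σ•ℓ_m = Σ_k (−1)^k (ζ_{m−2k}⁻¹ − 1)/2^k`), **`ell_add_smul_ell_two_eq_sum_v`**
  (`ℓ_m + σ•ℓ_m = Σ_{k<m} (−1)^k v_{m−2k}/2^k`), `v_mem_adjoin_u_of_le`, **`ell_add_smul_ell_sub_v_mem_adjoin_u`**
  (`ℓ_{m+2} + σ•ℓ_{m+2} − v_{m+2} ∈ ℚ₂(u_m)`) and `…_succ` (`∈ ℚ₂(u_{m+1})`, the shape of (D4)'s `hgv` / file V's `heℓ`).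
* §2 (generic `ℤ₂`-model `M` with elliptic generic fibre, `hV : genFibΩ 2 M = W ⊗ ℚ̄₂`, cyclotomic `κ`, any `ι`; a local point `c`
  whose model avatar `c̃ = (toLoc hV).symm c` lies in `L(n+2) ∩ E₁` with `Λ c̃ = ℓ_{n+2}`; `σ` an inverter of `ζ_{2^{n+2}}`)
  **`plusHondaGenerator_two`**: `g := (toLoc hV).symm (c + σ • c)` lies in `L(n+2) ∩ E₁`, `Λ g = ℓ_{n+2} + σ•ℓ_{n+2}`,
  `Λ g − v_{n+2} ∈ ℚ₂(u_{n+1})`, and `c + σ • c ∈ E(ℚ_{2,n}·ℚ₂)`.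
HONEST FRAMING: THEOREMS ONLY (no definition, no named fact, no instance, no `sorry`), route-independent (no `Theses` import);
pure local algebra on the tree's cyclotomic tower and local points; nothing about any Selmer group; closes no item; BSD is not
proved by any of this.

References: [Kobayashi2003] S. Kobayashi, Invent. Math. 152 (2003), §8.4 (Lemma 8.9, Prop. 8.11, Prop. 8.12);
[KuriharaOtsuki2006] M. Kurihara, R. Otsuki, §1.3, Prop. 1.4, p. 557; [Washington1997] §13.1; [SilvermanAEC2009] IV.6.4.
-/

set_option autoImplicit false
-- the Theorems namespace of this sub repeats the summit name by design (D-0017 nested layout)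
set_option linter.dupNamespace false

noncomputable section

open scoped Classical IntermediateField
open Finset

namespace Summit.BirchSwinnertonDyer.BirchSwinnertonDyer.Theorems.SignedEC.PlusHonda

open Field WeierstrassCurve Literature.NumberTheory.EllipticCurves Literature.NumberTheory.GaloisRepresentations
  Literature.NumberTheory.EllipticCurves.ZpExtension Literature.NumberTheory.EllipticCurves.Kobayashi2003
  Literature.NumberTheory.EllipticCurves.FormalGroupChart
  Summit.BirchSwinnertonDyer.Rank1Residual.Additive Summit.BirchSwinnertonDyer.Rank1Residual.Additive.PadicCyclotomicTower
  Summit.BirchSwinnertonDyer.Rank1Residual.Additive.BallEval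
  Summit.BirchSwinnertonDyer.BirchSwinnertonDyer.Theorems.SignedKatoOffTwo.LocalTwo
  Summit.BirchSwinnertonDyer.BirchSwinnertonDyer.Theorems.SignedEC.PlusLayer

/-! ## §1 The logarithm of the plus Honda point: `ℓ_m + σℓ_m = Σ_k (−1)^k v_{m−2k}/2^k ≡ v_m (mod ℚ₂(u_{m−2}))` -/

section Ell

/-- **`σ • ℓ_m` for an inverter `σ` of `ζ_{2^m}`**: `σ` inverts every `ζ_{2^j}`, `j ≤ m`, so
`σ•ℓ_m = Σ_{k<m} (−1)^k (ζ_{2^{m−2k}}⁻¹ − 1)/2^k`. [cite: Kobayashi2003, §8.4 (ℓ_m)] [cite: Washington1997, §13.1] -/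
theorem smul_ell_two_of_inverter {m : ℕ} {σ : absoluteGaloisGroup ℚ_[2]} (hσ : σ • zeta 2 m = (zeta 2 m)⁻¹) :
    σ • ell 2 m = ∑ k ∈ range m, (-1) ^ k * ((zeta 2 (m - 2 * k))⁻¹ - 1) / ((2 : ℕ) : PadicAlgCl 2) ^ k := by
  rw [absoluteGaloisGroup.smul_def, ell, map_sum]
  refine sum_congr rfl fun k _ ↦ ?_
  have hz : absoluteGaloisGroup.toAlgEquiv ℚ_[2] σ (zeta 2 (m - 2 * k)) = (zeta 2 (m - 2 * k))⁻¹ := by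
    rw [← absoluteGaloisGroup.smul_def]
    exact smul_zeta_eq_inv_of_le (by omega) hσ
  simp only [map_div₀, map_mul, map_pow, map_neg, map_one, map_sub, map_natCast, hz]

/-- **`ℓ_m + σ•ℓ_m = Σ_{k<m} (−1)^k v_{m−2k}/2^k`** (`v_j = ζ_{2^j} + ζ_{2^j}⁻¹ − 2`) for every inverter `σ` of `ζ_{2^m}` — the
logarithm of the `Δ`-trace `e = c_m + σc_m` of Kobayashi's point (the lead's memo LAGPLUS-AT-2-CONSTRUCTION §2 formula
`log e_n = Σ_k (−1)^k v_{n−2k}/2^k`). [cite: Kobayashi2003, §8.4, Lemma 8.9] [cite: KuriharaOtsuki2006, §1.3, p. 557] -/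
theorem ell_add_smul_ell_two_eq_sum_v {m : ℕ} {σ : absoluteGaloisGroup ℚ_[2]} (hσ : σ • zeta 2 m = (zeta 2 m)⁻¹) :
    ell 2 m + σ • ell 2 m =
      ∑ k ∈ range m, (-1) ^ k * (zeta 2 (m - 2 * k) + (zeta 2 (m - 2 * k))⁻¹ - 2) / ((2 : ℕ) : PadicAlgCl 2) ^ k := by
  rw [smul_ell_two_of_inverter hσ, ell, ← sum_add_distrib]
  refine sum_congr rfl fun k _ ↦ ?_
  ring

/-- `v_j ∈ ℚ₂(u_m)` for `j ≤ m` (the plus fields increase). [cite: Washington1997, §13.1] -/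
theorem v_mem_adjoin_u_of_le {j m : ℕ} (h : j ≤ m) :
    zeta 2 j + (zeta 2 j)⁻¹ - 2 ∈ ℚ_[2]⟮zeta 2 m + (zeta 2 m)⁻¹⟯ :=
  adjoin_u_mono h (v_mem_adjoin_u j)

/-- **`ℓ_{m+2} + σ•ℓ_{m+2} − v_{m+2} ∈ ℚ₂(u_m)`** for every inverter `σ` of `ζ_{2^{m+2}}`: the terms `k ≥ 1` of the sum are
`± v_{m−2k'}/2^{k'+1} ∈ ℚ₂(u_m)`. [cite: Kobayashi2003, §8.4, Lemma 8.9] [cite: KuriharaOtsuki2006, §1.3] -/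
theorem ell_add_smul_ell_sub_v_mem_adjoin_u (m : ℕ) {σ : absoluteGaloisGroup ℚ_[2]}
    (hσ : σ • zeta 2 (m + 2) = (zeta 2 (m + 2))⁻¹) :
    ell 2 (m + 2) + σ • ell 2 (m + 2) - (zeta 2 (m + 2) + (zeta 2 (m + 2))⁻¹ - 2) ∈
      ℚ_[2]⟮zeta 2 m + (zeta 2 m)⁻¹⟯ := by
  set K := ℚ_[2]⟮zeta 2 m + (zeta 2 m)⁻¹⟯ with hK
  rw [ell_add_smul_ell_two_eq_sum_v hσ, sum_range_succ']
  simp only [pow_zero, one_mul, mul_zero, Nat.sub_zero, div_one, add_sub_cancel_right]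
  refine IntermediateField.sum_mem _ fun k hk ↦ ?_
  have hkm : k < m + 1 := mem_range.mp hk
  have hv : zeta 2 (m + 2 - 2 * (k + 1)) + (zeta 2 (m + 2 - 2 * (k + 1)))⁻¹ - 2 ∈ K :=
    v_mem_adjoin_u_of_le (by omega)
  have h2 : ((2 : ℕ) : PadicAlgCl 2) ∈ K := IntermediateField.natCast_mem K 2
  exact div_mem (mul_mem (pow_mem (neg_mem (one_mem K)) (k + 1)) hv) (pow_mem h2 (k + 1))

/-- **`ℓ_{m+2} + σ•ℓ_{m+2} − v_{m+2} ∈ ℚ₂(u_{m+1})`** — the shape of width seat 2's (D4) input `hgv` (level `n = m`, generator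
logarithm `≡ u_{n+2} − 2 (mod ℚ₂(u_{n+1}))`) and of the lead's file V input `heℓ` (`N + 1 = m + 2`). [cite: Kobayashi2003, §8.4] -/
theorem ell_add_smul_ell_sub_v_mem_adjoin_u_succ (m : ℕ) {σ : absoluteGaloisGroup ℚ_[2]}
    (hσ : σ • zeta 2 (m + 2) = (zeta 2 (m + 2))⁻¹) :
    ell 2 (m + 2) + σ • ell 2 (m + 2) - (zeta 2 (m + 2) + (zeta 2 (m + 2))⁻¹ - 2) ∈
      ℚ_[2]⟮zeta 2 (m + 1) + (zeta 2 (m + 1))⁻¹⟯ :=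
  adjoin_u_mono (Nat.le_succ m) (ell_add_smul_ell_sub_v_mem_adjoin_u m hσ)

end Ell

/-! ## §2 The model-level generator `g_n = c̃ + σ·c̃` -/

section Generator

variable {M : WeierstrassCurve ℤ_[2]} [hE : (M.map PadicInt.Coe.ringHom).IsElliptic]
  {W : WeierstrassCurve ℚ} (hV : genFibΩ 2 M = W.baseChange (AlgebraicClosure ℚ_[2]))
  {κ : ZpExtension ℚ 2} (ι : AlgebraicClosure ℚ →ₐ[ℚ] PadicAlgCl 2)

omit hE in
/-- The model avatar of `σ • c` is `act σ c̃` for the transported action `act σ Q = (toLoc hV).symm (σ • toLoc hV Q)`. [folklore] -/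
theorem toLoc_symm_smul (σ : absoluteGaloisGroup ℚ_[2]) (c : localPoints W ℚ_[2]) :
    (toLoc hV).symm (σ • c) = (toLoc hV).symm (σ • toLoc hV ((toLoc hV).symm c)) := by
  rw [AddEquiv.apply_symm_apply]

/-- **THE MODEL-LEVEL PLUS HONDA GENERATOR.** `M/ℤ₂` a model of `W ⊗ ℚ̄₂` with elliptic generic fibre, `κ` cyclotomic, `ι` any;
`c ∈ E(ℚ̄₂)` a local point whose model avatar `c̃ = (toLoc hV).symm c` has coordinates in `ℚ₂(ζ_{2^{n+2}})`, lies in the kernel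
of reduction and has `Λ c̃ = ℓ_{n+2}` (the K3 lead's tower point `c_{n+2}`); `σ` an inverter of `ζ_{2^{n+2}}`. Then the avatar
`g = (toLoc hV).symm (c + σ • c)` of the `Δ`-trace `e_n = c + σ • c` (i) has coordinates in `ℚ₂(ζ_{2^{n+2}})`, (ii) lies in the
kernel of reduction, (iii) has `Λ g = ℓ_{n+2} + σ•ℓ_{n+2}`, (iv) `Λ g − v_{n+2} ∈ ℚ₂(u_{n+1})` (the `hgv` of (D4)), and (v)
`e_n ∈ E(ℚ_{2,n}·ℚ₂)`. [cite: Kobayashi2003, §8.4, Lemma 8.9, Prop. 8.11] [cite: KuriharaOtsuki2006, §1.3, Prop. 1.4] -/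
theorem plusHondaGenerator_two (hκ : κ.IsCyclotomic) {n : ℕ} {σ : absoluteGaloisGroup ℚ_[2]}
    (hσ : σ • zeta 2 (n + 2) = (zeta 2 (n + 2))⁻¹) {c : localPoints W ℚ_[2]}
    (hcL : haveI := isIntegral_genFib_baseChange 2 M
      (toLoc hV).symm c ∈ subfieldPoints (genFibΩ 2 M) (layer 2 (n + 2)).toSubfield coeffs_mem_layer)
    (hck : haveI := isIntegral_genFib_baseChange 2 M
      (toLoc hV).symm c ∈ kernel (Valued.v (R := PadicAlgCl 2)) (genFibΩ 2 M))
    (hcℓ : ptLogΩ 2 M ((toLoc hV).symm c) = ell 2 (n + 2)) :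
    haveI := isIntegral_genFib_baseChange 2 M
    (toLoc hV).symm (c + σ • c) ∈ subfieldPoints (genFibΩ 2 M) (layer 2 (n + 2)).toSubfield coeffs_mem_layer ∧
    (toLoc hV).symm (c + σ • c) ∈ kernel (Valued.v (R := PadicAlgCl 2)) (genFibΩ 2 M) ∧
    ptLogΩ 2 M ((toLoc hV).symm (c + σ • c)) = ell 2 (n + 2) + σ • ell 2 (n + 2) ∧
    ptLogΩ 2 M ((toLoc hV).symm (c + σ • c)) - (zeta 2 (n + 2) + (zeta 2 (n + 2))⁻¹ - 2) ∈
      ℚ_[2]⟮zeta 2 (n + 1) + (zeta 2 (n + 1))⁻¹⟯ ∧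
    c + σ • c ∈ localLayerPointsOfEmb κ ι W n := by
  haveI := isIntegral_genFib_baseChange 2 M
  haveI := isIntegral_curveK 2 (LayerField 2 (n + 2)) M
  set act : absoluteGaloisGroup ℚ_[2] → (genFibΩ 2 M).toAffine.Point → (genFibΩ 2 M).toAffine.Point :=
    fun τ Q ↦ (toLoc hV).symm (τ • toLoc hV Q) with hact
  have hsymm : (toLoc hV).symm (σ • c) = act σ ((toLoc hV).symm c) := toLoc_symm_smul hV σ c
  have hσL : (toLoc hV).symm (σ • c) ∈ subfieldPoints (genFibΩ 2 M) (layer 2 (n + 2)).toSubfield coeffs_mem_layer := by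
    rw [hsymm]; exact act_mem_subfieldPoints act (act_zero hV) (act_some hV) σ hcL
  have hσk : (toLoc hV).symm (σ • c) ∈ kernel (Valued.v (R := PadicAlgCl 2)) (genFibΩ 2 M) := by
    rw [hsymm]; exact act_mem_kernel act (act_zero hV) (act_some hV) σ (@hck)
  have hL : (toLoc hV).symm (c + σ • c) ∈ subfieldPoints (genFibΩ 2 M) (layer 2 (n + 2)).toSubfield coeffs_mem_layer := by
    rw [map_add]; exact (subfieldPoints _ _ _).add_mem hcL hσL
  have hk : (toLoc hV).symm (c + σ • c) ∈ kernel (Valued.v (R := PadicAlgCl 2)) (genFibΩ 2 M) := by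
    rw [map_add]; exact (kernel (Valued.v (R := PadicAlgCl 2)) (genFibΩ 2 M)).add_mem (@hck) (@hσk)
  have hΛ : ptLogΩ 2 M ((toLoc hV).symm (c + σ • c)) = ell 2 (n + 2) + σ • ell 2 (n + 2) := by
    rw [map_add, ptLogΩ_add (m := n + 2) hcL hσL (@hck) (@hσk), hsymm,
      ptLogΩ_act act (act_zero hV) (act_some hV) σ (norm_zCoord_lt_one_of_mem_kernel (@hck)), hcℓ]
  have hc : ∀ τ ∈ stab 2 (n + 2), τ • c = c := (forall_smul_eq_iff_mem_subfieldPoints hV (n + 2) c).mpr hcL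
  refine ⟨hL, hk, hΛ, ?_, add_smul_mem_localLayerPointsOfEmb_two_stab W ι hκ hσ hc⟩
  rw [hΛ]
  exact ell_add_smul_ell_sub_v_mem_adjoin_u_succ n hσ

end Generator

end Summit.BirchSwinnertonDyer.BirchSwinnertonDyer.Theorems.SignedEC.PlusHonda

end
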